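import Literature.NumberTheory.EllipticCurves.CanonicalPAdicHeightSqExistenceProofs
import Literature.NumberTheory.EllipticCurves.CanonicalPAdicHeightKProofs
import Literature.NumberTheory.QuadraticFields.SquareRootGenerator
import Literature.NumberTheory.QuadraticForms.PadicSquares
import HarnessLib

/-!
# The canonical `p`-adic height over a number field `K`, sigma-SQUARED form: the squared theta
# relation at `K`-points, the parallelogram law, and existence/uniqueness of the canonical
# `K`-datum at every prime `p` totally split in `K` admitting a sigma-squared pair — `p = 2` included
# (proofs only)

Trunk T-NT-EC (`Literature/NumberTheory/EllipticCurves`). Pure proof file (no definitions, no named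
facts): the `K`-side twin of `CanonicalPAdicHeightSqExistenceProofs.lean` (the `ℚ`-side) and the
Σ-twin of `CanonicalPAdicHeightKProofs.lean` (which does the same for `σ_p`, `p ≥ 5`). Recall
(`PadicSigmaSq.lean` §K) the sigma-squared `K`-height `canonicalPAdicHeightSqK W p K P =
log_p N𝔡(x(P)) − Σ_{ι : K → ℚ_p} log_p Σ_p(z(ιP))` (`p` totally split in `K`) and the predicate
`PAdicHeightDataK.IsCanonicalSq` — "the intended receptacle over `K = ℚ(√−7)` at `p = 2` (split)".
Until now no `DK` with `DK.IsCanonicalSq` was known to exist at `p = 2`. This file proves: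

* `padicSigmaSqEval_theta_padic`, `padicSigmaSqEval_theta_emb` — the squared theta relation
  `Σ_p(z(P+Q))Σ_p(z(P−Q)) = (x(Q) − x(P))²Σ_p(z(P))²Σ_p(z(Q))²` at `ℚ_p`-points of `E₁(ℚ_p)` and, along an
  embedding `ι : K → ℚ_p`, at `K`-points (from `IsMazurTateSigmaSqPair.thetaSq_formal`);
* `padicSigmaSqEval_emb_ne_zero` — `Σ_p(z(ιP)) ≠ 0` on `E(K) ∩ E₁` at `ι`;
* `some_mem_sigmaDiscSubgroupEmb_iff`, `exists_addSubgroup_coe_eq_localConditionsLocusK_of_isIntegral`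
  — **the `K`-admissible locus with `O` is a subgroup of `E(K)` at EVERY prime** (the two local
  conditions at `ι` cut out the pull-back of the level `E⁽ⁿ⁰⁾(ℚ_p)` of the formal-group filtration,
  `n₀ = 2` at `p = 2`, along Mathlib's homomorphism `Point.map ι`; extends the tree's `p ≠ 2` theorem
  `exists_addSubgroup_coe_eq_localConditionsLocusK`);
* `not_isOfFinAddOrder_of_inSigmaDisc_emb` — **that locus is torsion-free at every prime** (at
  `p = 2`: `Ê(4ℤ₂)` along `ι`; a prime-order multiple is impossible, for odd order by
  `val_le_one_of_zsmul_eq_zero`, for order `2` because `ψ₂² = 4x³ + b₂x² + 2b₄x + b₆ ≠ 0` when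
  `‖ι x‖₂ > 4` — AEC IV.6.1 at `p = 2`);
* `canonicalPAdicHeightSqK_parallelogram_of_exists` — the parallelogram law of the sigma-squared
  `K`-formula on generic admissible pairs (Néron's local laws at the finite places of `K`,
  `absNorm_denominatorIdeal_parallelogram`; the squared theta relation at each embedding; the product
  formula `∏_ι ι(δ) = N(δ)` at the totally split `p`) — MST 2006 §2.6–2.8 run on `Σ = σ²`;
* `exists_isCanonicalSqK_of_exists`, `PAdicHeightDataK.isCanonicalSq_unique`,
  `existsUnique_isCanonicalSqK_of_exists` — **existence (and uniqueness, given `W ⊗ K` globally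
  minimal) of a `K`-datum `DK : PAdicHeightDataK W p K` with `DK.IsCanonicalSq`** for every `ℤ`-integral
  elliptic `W/ℚ`, every number field `K` and every prime `p` totally split in `K` at which `W ⊗ ℚ_p`
  carries a sigma-squared pair;
* `exists_isCanonicalSqK_two`, `existsUnique_isCanonicalSqK_two` — **at `p = 2`** totally split in `K`
  (e.g. `K = ℚ(√−7)`), for `W/ℚ` globally minimal with good ORDINARY reduction at `2`, under the printed
  fact `mazurTate_sigmaSq_existsUnique_two` (Silverman 2005 §5 Rem. 2);
* `card_ringHom_padic_two_of_discr_mod_eight`, `exists_isCanonicalSqK_two_of_discr_mod_eight` — the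
  splitting hypothesis in embedding form, `#(K →+* ℚ₂) = [K : ℚ]`, for a QUADRATIC field with
  `d_K ≡ 1 (mod 8)` (Hensel mod `8` + Marcus Ch. 3 Thm. 25), e.g. `K = ℚ(√−7)` (`d_K = −7`), so that the
  `p = 2` existence theorem is instantiable from `[K : ℚ] = 2 ∧ d_K % 8 = 1`.

Nothing is asserted: no `sorry`, no new definition, no new named fact.

## Sources

* B. Mazur, W. Stein, J. Tate, Doc. Math. Extra Vol. Coates (2006): §1, §2.6–2.8 (the height over a
  number field as a sum of local terms; "`h_ρ` is quadratic because of property IV of `σ`").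
* J. S. Balakrishnan, M. Çiperiani, W. Stein, *`p`-adic heights of Heegner points and `Λ`-adic
  regulators*, Math. Comp. 84 (2015): §4.1 eq. (4.1) (the `K`-formula, `p` split).
* J. H. Silverman, Math. Ann. 332 (2005): §5 Rem. 2 (`σ²` at `p = 2`); *The Arithmetic of Elliptic
  Curves*, 2nd ed. (2009): IV.3.2, IV.6.1, VII.2.1–2.2, VII.3.4, Exercise 3.7.
* B. Mazur, J. Tate, Duke Math. J. 62 (1991): Thm. 3.1.
-/

noncomputable section

open scoped Classical NNReal
open IsDedekindDomain NumberField

namespace WeierstrassCurve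

open Literature.NumberTheory.EllipticCurves

/-! ### Evaluating the two sides of the squared theta relation (as in the `ℚ`-side file) -/

section Eval

open PowerSeries

variable {p : ℕ} [Fact p.Prime] (V : WeierstrassCurve ℚ_[p]) [hV : V.IsIntegral ℤ_[p]]

variable {V} in
/-- Value of the left side `(Σ(F)·Σ(u -_F v)·u⁴·v⁴)(u, v)`. [folklore] -/
private theorem padicEval₂_thetaSqLHS' {Sq : ℚ_[p]⟦X⟧} (hSq : IsPadicInt Sq) {u v : ℚ_[p]}
    (hu : ‖u‖ < 1) (hv : ‖v‖ < 1) :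
    padicEval₂ (Sq.subst V.formalGroupLaw * Sq.subst V.formalGroupLawSub *
        (MvPowerSeries.X 0 : MvPowerSeries (Fin 2) ℚ_[p]) ^ 4 * (MvPowerSeries.X 1) ^ 4) u v =
      padicEval Sq (padicEval₂ V.formalGroupLaw u v) *
        padicEval Sq (padicEval₂ V.formalGroupLaw u (padicEval V.formalNeg v)) * u ^ 4 * v ^ 4 := by
  have hF := V.isPadicInt_formalGroupLaw
  have h1 := hSq.powerSeries_subst hF V.hasSubst_formalGroupLaw
  have hFs := V.isPadicInt_formalGroupLawSub
  have h2 := hSq.powerSeries_subst hFs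
    (PowerSeries.HasSubst.of_constantCoeff_zero V.constantCoeff_formalGroupLawSub)
  have hX0 : IsPadicInt ((MvPowerSeries.X 0 : MvPowerSeries (Fin 2) ℚ_[p]) ^ 4) :=
    (IsPadicInt.X 0).pow 4
  have hX1 : IsPadicInt ((MvPowerSeries.X 1 : MvPowerSeries (Fin 2) ℚ_[p]) ^ 4) :=
    (IsPadicInt.X 1).pow 4
  rw [padicEval₂_mul ((h1.mul h2).mul hX0) hX1 hu hv, padicEval₂_mul (h1.mul h2) hX0 hu hv,
    padicEval₂_mul h1 h2 hu hv, padicEval₂_pow (IsPadicInt.X 0) hu hv,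
    padicEval₂_pow (IsPadicInt.X 1) hu hv, padicEval₂_X, padicEval₂_X,
    padicEval₂_subst hSq hF V.constantCoeff_formalGroupLaw hu hv,
    padicEval₂_subst hSq hFs V.constantCoeff_formalGroupLawSub hu hv]
  unfold formalGroupLawSub
  rw [padicEval₂_substPair hF (IsPadicInt.X 0) (V.isPadicInt_formalNeg.powerSeries_subst
      (IsPadicInt.X 1) (PowerSeries.HasSubst.X 1)) (MvPowerSeries.constantCoeff_X 0)
      (V.constantCoeff_formalNeg_subst_X 1) hu hv,
    padicEval₂_X, padicEval₂_subst_X V.isPadicInt_formalNeg hu hv]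
  rfl

variable {V} in
/-- Value of the right side `((u²X(v) - v²X(u))²·Σ(u)²·Σ(v)²)(u, v)`. [folklore] -/
private theorem padicEval₂_thetaSqRHS' {Sq : ℚ_[p]⟦X⟧} (hSq : IsPadicInt Sq) {u v : ℚ_[p]}
    (hu : ‖u‖ < 1) (hv : ‖v‖ < 1) :
    padicEval₂ (((MvPowerSeries.X 0 : MvPowerSeries (Fin 2) ℚ_[p]) ^ 2 *
          V.formalXMulSq.subst (MvPowerSeries.X 1 : MvPowerSeries (Fin 2) ℚ_[p]) -
          (MvPowerSeries.X 1) ^ 2 *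
            V.formalXMulSq.subst (MvPowerSeries.X 0 : MvPowerSeries (Fin 2) ℚ_[p])) ^ 2 *
        Sq.subst (MvPowerSeries.X 0 : MvPowerSeries (Fin 2) ℚ_[p]) ^ 2 *
        Sq.subst (MvPowerSeries.X 1 : MvPowerSeries (Fin 2) ℚ_[p]) ^ 2) u v =
      (u ^ 2 * padicEval V.formalXMulSq v - v ^ 2 * padicEval V.formalXMulSq u) ^ 2 *
        padicEval Sq u ^ 2 * padicEval Sq v ^ 2 := by
  have hXs0 := V.isPadicInt_formalXMulSq.powerSeries_subst (IsPadicInt.X (0 : Fin 2))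
    (PowerSeries.HasSubst.X 0)
  have hXs1 := V.isPadicInt_formalXMulSq.powerSeries_subst (IsPadicInt.X (1 : Fin 2))
    (PowerSeries.HasSubst.X 1)
  have hs0 := hSq.powerSeries_subst (IsPadicInt.X (0 : Fin 2)) (PowerSeries.HasSubst.X 0)
  have hs1 := hSq.powerSeries_subst (IsPadicInt.X (1 : Fin 2)) (PowerSeries.HasSubst.X 1)
  have hX0 : IsPadicInt ((MvPowerSeries.X 0 : MvPowerSeries (Fin 2) ℚ_[p]) ^ 2) :=
    (IsPadicInt.X 0).pow 2
  have hX1 : IsPadicInt ((MvPowerSeries.X 1 : MvPowerSeries (Fin 2) ℚ_[p]) ^ 2) :=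
    (IsPadicInt.X 1).pow 2
  have hd := (hX0.mul hXs1).sub (hX1.mul hXs0)
  rw [padicEval₂_mul ((hd.pow 2).mul (hs0.pow 2)) (hs1.pow 2) hu hv,
    padicEval₂_mul (hd.pow 2) (hs0.pow 2) hu hv, padicEval₂_pow hd hu hv,
    padicEval₂_sub (hX0.mul hXs1) (hX1.mul hXs0) hu hv, padicEval₂_mul hX0 hXs1 hu hv,
    padicEval₂_mul hX1 hXs0 hu hv, padicEval₂_pow hs0 hu hv, padicEval₂_pow hs1 hu hv,
    padicEval₂_pow (IsPadicInt.X 0) hu hv, padicEval₂_pow (IsPadicInt.X 1) hu hv, padicEval₂_X,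
    padicEval₂_X, padicEval₂_subst_X V.isPadicInt_formalXMulSq hu hv,
    padicEval₂_subst_X V.isPadicInt_formalXMulSq hu hv, padicEval₂_subst_X hSq hu hv,
    padicEval₂_subst_X hSq hu hv]
  rfl

end Eval

/-! ### The squared theta relation at `ℚ_p`-points and at `K`-points of the kernel of reduction -/

section Theta

variable (W : WeierstrassCurve ℚ) [W.IsElliptic] [W.IsIntegral ℤ] (p : ℕ) [Fact p.Prime]

/-- **The squared theta relation at `ℚ_p`-points, for any sigma-squared pair** (core computation):
for `V/ℚ_p` elliptic with `p`-integral coefficients, a sigma-squared pair `(Σ, c)` of `V`, and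
`P = (x₁, y₁)`, `Q = (x₂, y₂) ∈ E₁(ℚ_p)`:
`Σ̂(z(P+Q))·Σ̂(z(P−Q)) = (x₂ − x₁)²·Σ̂(z(P))²·Σ̂(z(Q))²` — evaluate `IsMazurTateSigmaSqPair.thetaSq_formal`
at `(z(P), z(Q))`, read the formal group law as the chord-tangent law (`formalGroupLaw_padicEval_holds`),
`î(z Q) = z(−Q)`, `X̂(z P) = x(P)z(P)²`, and cancel `z(P)⁴z(Q)⁴`. Σ-twin of
`padicEval_theta_of_thetaLHS_eq`; valid at `p = 2`. [Mazur–Tate 1991, Thm. 3.1; Blakestad–Grant 2023,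
Prop. 14 and Thm. 15] [cite: BlakestadGrant2023, Thm. 15] [cite: MazurTate1991, Thm. 3.1] -/
theorem IsMazurTateSigmaSqPair.theta_padic {p : ℕ} [Fact p.Prime] {V : WeierstrassCurve ℚ_[p]}
    [V.IsElliptic] [V.IsIntegral ℤ_[p]] {Sq : PowerSeries ℚ_[p]} {c : ℚ_[p]}
    (hpair : V.IsMazurTateSigmaSqPair Sq c) {x₁ y₁ x₂ y₂ : ℚ_[p]}
    (h₁ : V.toAffine.Nonsingular x₁ y₁) (h₂ : V.toAffine.Nonsingular x₂ y₂) (hx₁ : 1 < ‖x₁‖)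
    (hx₂ : 1 < ‖x₂‖) :
    padicEval Sq (V.formalParameter (.some x₁ y₁ h₁ + .some x₂ y₂ h₂)) *
        padicEval Sq (V.formalParameter (.some x₁ y₁ h₁ - .some x₂ y₂ h₂)) =
      (x₂ - x₁) ^ 2 * padicEval Sq (-x₁ / y₁) ^ 2 * padicEval Sq (-x₂ / y₂) ^ 2 := by
  have hint : IsPadicInt Sq := hpair.isPadicInt
  have hΘ := hpair.thetaSq_formal
  have hFadd := formalGroupLaw_padicEval_holds p V
  -- the points
  set P : V.toAffine.Point := .some x₁ y₁ h₁ with hPdef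
  set Q : V.toAffine.Point := .some x₂ y₂ h₂ with hQdef
  have hnQ : -Q = .some x₂ (V.toAffine.negY x₂ y₂) ((Affine.nonsingular_neg ..).mpr h₂) := by
    rw [hQdef, Affine.Point.neg_some]
  have hkP : V.IsInReductionKernel P := hx₁
  have hkQ : V.IsInReductionKernel Q := hx₂
  have hknQ : V.IsInReductionKernel (-Q) := by rw [hnQ]; exact hx₂
  -- parameters
  obtain ⟨-, hu0, hu1, -, -⟩ := V.param_facts h₁.1 hx₁
  obtain ⟨-, hv0, hv1, -, -⟩ := V.param_facts h₂.1 hx₂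
  set u : ℚ_[p] := -x₁ / y₁ with hudef
  set v : ℚ_[p] := -x₂ / y₂ with hvdef
  have hzP : V.formalParameter P = u := rfl
  have hzQ : V.formalParameter Q = v := rfl
  have hznQ : V.formalParameter (-Q) = padicEval V.formalNeg v := by
    rw [hnQ, V.padicEval_formalNeg_eq h₂.1 hx₂]; rfl
  -- the formal group law at `(P, Q)` and `(P, -Q)`
  have hadd : padicEval₂ V.formalGroupLaw u v = V.formalParameter (P + Q) := by
    rw [← hzP, ← hzQ]; exact hFadd _ _ hkP hkQ
  have hsub : padicEval₂ V.formalGroupLaw u (padicEval V.formalNeg v) =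
      V.formalParameter (P - Q) := by
    rw [← hzP, ← hznQ, sub_eq_add_neg]; exact hFadd _ _ hkP hknQ
  -- the dictionary for `X = z²x`
  have hXu : padicEval V.formalXMulSq u = x₁ * u ^ 2 := V.padicEval_formalXMulSq_eq h₁.1 hx₁
  have hXv : padicEval V.formalXMulSq v = x₂ * v ^ 2 := V.padicEval_formalXMulSq_eq h₂.1 hx₂
  -- evaluate the formal identity at `(u, v)`
  have key := congrArg (fun G => padicEval₂ G u v) hΘ
  rw [padicEval₂_thetaSqLHS' hint hu1 hv1, padicEval₂_thetaSqRHS' hint hu1 hv1, hadd, hsub, hXu,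
    hXv] at key
  have huv : u ^ 4 * v ^ 4 ≠ 0 := mul_ne_zero (pow_ne_zero 4 hu0) (pow_ne_zero 4 hv0)
  apply mul_right_cancel₀ huv
  linear_combination key

/-- **The squared theta relation at `ℚ_p`-points of `E₁(ℚ_p)` for `Σ_p = padicSigmaSq`**: for `W/ℚ`
elliptic with `ℤ`-integral equation, a prime `p` at which `W ⊗ ℚ_p` carries a sigma-squared pair (so
that `Σ_p` is one), and `P = (x₁, y₁)`, `Q = (x₂, y₂) ∈ E(ℚ_p)` with `‖x₁‖, ‖x₂‖ > 1`:
`Σ_p(z(P+Q))·Σ_p(z(P−Q)) = (x₂ − x₁)²·Σ_p(z(P))²·Σ_p(z(Q))²` (`z = −x/y`). The `ℚ_p`-point form of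
`padicSigmaSqEval_theta_of_exists` (there for rational points); valid at `p = 2`.
[Mazur–Tate 1991, Thm. 3.1; Blakestad–Grant 2023, Thm. 15; Mazur–Stein–Tate 2006, §2.3, §2.7]
[cite: BlakestadGrant2023, Thm. 15] [cite: MazurTate1991, Thm. 3.1] -/
theorem padicSigmaSqEval_theta_padic
    (hex : ∃ Sq : PowerSeries ℚ_[p], ∃ c : ℚ_[p], (W.baseChange ℚ_[p]).IsMazurTateSigmaSqPair Sq c)
    {x₁ y₁ x₂ y₂ : ℚ_[p]} (h₁ : (W.baseChange ℚ_[p]).toAffine.Nonsingular x₁ y₁)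
    (h₂ : (W.baseChange ℚ_[p]).toAffine.Nonsingular x₂ y₂) (hx₁ : 1 < ‖x₁‖) (hx₂ : 1 < ‖x₂‖) :
    W.padicSigmaSqEval p ((W.baseChange ℚ_[p]).formalParameter (.some x₁ y₁ h₁ + .some x₂ y₂ h₂)) *
        W.padicSigmaSqEval p
          ((W.baseChange ℚ_[p]).formalParameter (.some x₁ y₁ h₁ - .some x₂ y₂ h₂)) =
      (x₂ - x₁) ^ 2 * W.padicSigmaSqEval p (-x₁ / y₁) ^ 2 * W.padicSigmaSqEval p (-x₂ / y₂) ^ 2 := by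
  haveI : (W.baseChange ℚ_[p]).IsElliptic := by rw [baseChange]; infer_instance
  have hpair := isMazurTateSigmaSqPair_padicSigmaSq (W := W.baseChange ℚ_[p]) (Or.inr hex)
  simp only [padicSigmaSqEval]
  exact hpair.theta_padic h₁ h₂ hx₁ hx₂

/-- **The squared theta relation at `K`-points under an embedding `ι : K → ℚ_p`.** For `W/ℚ` elliptic
with `ℤ`-integral equation, `p` a prime at which `W ⊗ ℚ_p` carries a sigma-squared pair, a number
field `K`, `ι : K → ℚ_p`, and `P = (x₁, y₁)`, `Q = (x₂, y₂) ∈ E(K)` with `‖ι x₁‖, ‖ι x₂‖ > 1`,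
`P + Q = (x₃, y₃)`, `P − Q = (x₄, y₄)`:
`Σ_p(z(ιP₃))·Σ_p(z(ιP₄)) = (ι x₂ − ι x₁)²·Σ_p(z(ιP))²·Σ_p(z(ιQ))²` — the `ℚ_p`-point relation
transported along Mathlib's homomorphism `Point.map ι : E(K) → E(ℚ_p)`. The local identity at the
places above `p` behind "`h_ρ` is quadratic because of property IV of `σ`" (MST 2006 §2.7), in the
squared form valid at `p = 2`. [Mazur–Stein–Tate 2006, §2.3, §2.7; Mazur–Tate 1991, Thm. 3.1]
[cite: MazurSteinTate2006, §2.7] -/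
theorem padicSigmaSqEval_theta_emb
    (hex : ∃ Sq : PowerSeries ℚ_[p], ∃ c : ℚ_[p], (W.baseChange ℚ_[p]).IsMazurTateSigmaSqPair Sq c)
    (K : Type) [Field K] [NumberField K] (ι : K →+* ℚ_[p]) {x₁ y₁ x₂ y₂ x₃ y₃ x₄ y₄ : K}
    (h₁ : (W.baseChange K).toAffine.Nonsingular x₁ y₁)
    (h₂ : (W.baseChange K).toAffine.Nonsingular x₂ y₂)
    (h₃ : (W.baseChange K).toAffine.Nonsingular x₃ y₃)
    (h₄ : (W.baseChange K).toAffine.Nonsingular x₄ y₄)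
    (hS : (.some x₁ y₁ h₁ : (W.baseChange K).toAffine.Point) + .some x₂ y₂ h₂ = .some x₃ y₃ h₃)
    (hD : (.some x₁ y₁ h₁ : (W.baseChange K).toAffine.Point) - .some x₂ y₂ h₂ = .some x₄ y₄ h₄)
    (hx₁ : 1 < ‖ι x₁‖) (hx₂ : 1 < ‖ι x₂‖) :
    W.padicSigmaSqEval p (-ι x₃ / ι y₃) * W.padicSigmaSqEval p (-ι x₄ / ι y₄) =
      (ι x₂ - ι x₁) ^ 2 * W.padicSigmaSqEval p (-ι x₁ / ι y₁) ^ 2 *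
        W.padicSigmaSqEval p (-ι x₂ / ι y₂) ^ 2 := by
  set f : (W.baseChange K).toAffine.Point →+ (W.baseChange ℚ_[p]).toAffine.Point :=
    Affine.Point.map (W' := W.toAffine) (S := ℚ) ι.toRatAlgHom with hf
  have hh : ∀ {x y : K}, (W.baseChange K).toAffine.Nonsingular x y →
      (W.baseChange ℚ_[p]).toAffine.Nonsingular (ι x) (ι y) := fun {x y} h =>
    (Affine.baseChange_nonsingular (W := W.toAffine) (f := ι.toRatAlgHom)
      ι.toRatAlgHom.toRingHom.injective x y).mpr h
  have hfP : ∀ {x y : K} (h : (W.baseChange K).toAffine.Nonsingular x y),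
      f (.some x y h) = .some (ι x) (ι y) (hh h) := fun h => rfl
  have key := W.padicSigmaSqEval_theta_padic p hex (hh h₁) (hh h₂) hx₁ hx₂
  rw [← hfP h₁, ← hfP h₂, ← map_add, ← map_sub, hS, hD, hfP h₃, hfP h₄, formalParameter_some,
    formalParameter_some] at key
  exact key

omit [W.IsElliptic] in
/-- **`Σ_p(z(ιP)) ≠ 0` for `P = (x, y) ∈ E(K)` with `‖ι x‖ > 1`, at every prime** (`ℤ`-integral
equation): `z(ιP) = −ι x/ι y` lies in the punctured open unit disc and `Σ_p ∈ t² + t³ℤ_p⟦t⟧`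
(`padicSigmaSqEval_ne_zero`). [Mazur–Stein–Tate 2006, §2.3] [cite: MazurSteinTate2006, §2.3] -/
theorem padicSigmaSqEval_emb_ne_zero (K : Type) [Field K] [NumberField K] (ι : K →+* ℚ_[p])
    {x y : K} (h : (W.baseChange K).toAffine.Nonsingular x y) (hx : 1 < ‖ι x‖) :
    W.padicSigmaSqEval p (-ι x / ι y) ≠ 0 := by
  have hh : (W.baseChange ℚ_[p]).toAffine.Nonsingular (ι x) (ι y) :=
    (Affine.baseChange_nonsingular (W := W.toAffine) (f := ι.toRatAlgHom)
      ι.toRatAlgHom.toRingHom.injective x y).mpr h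
  obtain ⟨-, hz0, hz1, -, -⟩ := (W.baseChange ℚ_[p]).param_facts hh.1 hx
  exact W.padicSigmaSqEval_ne_zero p hz0 hz1

end Theta

/-! ### The `K`-admissible locus is a torsion-free subgroup, at every prime -/

section Locus

variable (W : WeierstrassCurve ℚ) [W.IsElliptic] [W.IsIntegral ℤ] (K : Type) [Field K] [NumberField K]
  (p : ℕ) [Fact p.Prime]

variable {W K p} in
/-- **`E(K) ∩ E⁽ⁿ⁾` at an embedding, in coordinates.** For `ι : K → ℚ_p` and an affine point `(x, y)`
of `E(K)`: `(x, y)` lies in the pull-back of the level-`n` subgroup `E⁽ⁿ⁾(ℚ_p)`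
(`WeierstrassCurve.formalFiltration`) along `Point.map ι : E(K) → E(ℚ_p)` iff `‖ι x‖_p > 1` and
`‖−ι x/ι y‖_p ≤ p⁻ⁿ`. [Silverman AEC VII.2.2, IV.3] [cite: SilvermanAEC2009, VII.2.2] -/
theorem some_mem_comap_formalFiltration_emb_iff (ι : K →+* ℚ_[p]) (n : ℕ) {x y : K}
    (h : (W.baseChange K).toAffine.Nonsingular x y) :
    (.some x y h : (W.baseChange K).toAffine.Point) ∈
        ((W.baseChange ℚ_[p]).formalFiltration n).comap
          (Affine.Point.map (W' := W.toAffine) (S := ℚ) ι.toRatAlgHom :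
            (W.baseChange K).toAffine.Point →+ (W.baseChange ℚ_[p]).toAffine.Point) ↔
      1 < ‖ι x‖ ∧ ‖-ι x / ι y‖ ≤ ((p : ℝ)⁻¹) ^ n := by
  have hh : (W.baseChange ℚ_[p]).toAffine.Nonsingular (ι x) (ι y) :=
    (Affine.baseChange_nonsingular (W := W.toAffine) (f := ι.toRatAlgHom)
      ι.toRatAlgHom.toRingHom.injective x y).mpr h
  have hfP : (Affine.Point.map (W' := W.toAffine) (S := ℚ) ι.toRatAlgHom :
      (W.baseChange K).toAffine.Point →+ (W.baseChange ℚ_[p]).toAffine.Point) (.some x y h) =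
        .some (ι x) (ι y) hh := rfl
  rw [AddSubgroup.mem_comap, hfP, mem_formalFiltration_iff, isInReductionKernel_some,
    formalParameter_some]

variable {W K p} in
/-- **The two local conditions at `ι` cut out `E(K) ∩ E⁽ⁿ⁰⁾` at `ι`** (`n₀ = 2` for `p = 2`, `1`
otherwise): `(x, y)` lies in the pull-back of `E⁽ⁿ⁰⁾(ℚ_p)` along `Point.map ι` iff `‖ι x‖_p > 1` and
`z(ιP) = −ι x/ι y` lies in the sigma disc (`padicNorm_le_inv_pow_iff_inSigmaDisc`; `‖z(ιP)‖ < 1` on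
`E₁`). For `p = 2` this is `Ê(4ℤ₂)` along `ι`. [Silverman AEC VII.2.2, IV.3.2(a); Stein–Wuthrich 2013,
§4] [cite: SilvermanAEC2009, IV.3.2] [cite: SteinWuthrich2013, §4] -/
theorem some_mem_sigmaDiscSubgroupEmb_iff (ι : K →+* ℚ_[p]) {x y : K}
    (h : (W.baseChange K).toAffine.Nonsingular x y) :
    (.some x y h : (W.baseChange K).toAffine.Point) ∈
        ((W.baseChange ℚ_[p]).formalFiltration (if p = 2 then 2 else 1)).comap
          (Affine.Point.map (W' := W.toAffine) (S := ℚ) ι.toRatAlgHom :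
            (W.baseChange K).toAffine.Point →+ (W.baseChange ℚ_[p]).toAffine.Point) ↔
      1 < ‖ι x‖ ∧ InSigmaDisc p (-ι x / ι y) := by
  rw [some_mem_comap_formalFiltration_emb_iff]
  refine and_congr_right fun hx => padicNorm_le_inv_pow_iff_inSigmaDisc p ?_
  have hh : (W.baseChange ℚ_[p]).toAffine.Nonsingular (ι x) (ι y) :=
    (Affine.baseChange_nonsingular (W := W.toAffine) (f := ι.toRatAlgHom)
      ι.toRatAlgHom.toRingHom.injective x y).mpr h
  exact ((W.baseChange ℚ_[p]).param_facts hh.1 hx).2.2.1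

/-- **The `K`-admissible locus with `O` is a subgroup of `E(K)`, at every prime.** For `W/ℚ` elliptic
with integer coefficients, a number field `K` and ANY prime `p`,
`{O} ∪ {P | SatisfiesLocalConditionsK p K P}` is the underlying set of the subgroup
`(⨅_ι Point.map ι ⁻¹ E⁽ⁿ⁰⁾(ℚ_p)) ⊓ (⨅_v E₀ at v)` (`n₀ = 2` if `p = 2`, else `1`): `E₀` at `v` is a
subgroup by AEC VII.2.1 (`nonsingularReductionSubgroupAtPlace`), `E⁽ⁿ⁾(ℚ_p) ≅ Ê(𝓜ⁿ)` by AEC IV.3.2(a)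
/ VII.2.2 (`formalFiltration`), and `Point.map ι` is a homomorphism. Extends the tree's
`exists_addSubgroup_coe_eq_localConditionsLocusK` (`p ≠ 2`) to `p = 2`.
[Silverman AEC VII.2.1, VII.2.2, IV.3.2(a); Balakrishnan–Çiperiani–Stein 2015, §4.1 (conditions (1),
(2)); Mazur–Stein–Tate 2006, §2.6] [cite: SilvermanAEC2009, VII.2.1] -/
theorem exists_addSubgroup_coe_eq_localConditionsLocusK_of_isIntegral :
    ∃ H : AddSubgroup (W.baseChange K).toAffine.Point,
      (H : Set (W.baseChange K).toAffine.Point) =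
        {P | P = 0 ∨ W.SatisfiesLocalConditionsK p K P} := by
  refine ⟨(⨅ ι : K →+* ℚ_[p], ((W.baseChange ℚ_[p]).formalFiltration (if p = 2 then 2 else 1)).comap
      (Affine.Point.map (W' := W.toAffine) (S := ℚ) ι.toRatAlgHom :
        (W.baseChange K).toAffine.Point →+ (W.baseChange ℚ_[p]).toAffine.Point)) ⊓
    ⨅ v : HeightOneSpectrum (𝓞 K), nonsingularReductionSubgroupAtPlace W K v, ?_⟩
  ext P
  rw [SetLike.mem_coe, AddSubgroup.mem_inf, AddSubgroup.mem_iInf, AddSubgroup.mem_iInf,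
    Set.mem_setOf_eq]
  rcases P with _ | ⟨x, y, h⟩
  · simp only [WeierstrassCurve.Affine.Point.zero_def, true_or, iff_true]
    exact ⟨fun ι => AddSubgroup.zero_mem _, fun v => AddSubgroup.zero_mem _⟩
  · constructor
    · rintro ⟨hx, hns⟩
      exact Or.inr ⟨fun ι => (some_mem_sigmaDiscSubgroupEmb_iff ι h).mp (hx ι),
        fun v => (some_mem_nonsingularReductionSubgroupAtPlace_iff v h).mp (hns v)⟩
    · rintro (h0 | ⟨hx, hns⟩)
      · exact (WeierstrassCurve.Affine.Point.some_ne_zero h h0).elim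
      · exact ⟨fun ι => (some_mem_sigmaDiscSubgroupEmb_iff ι h).mpr (hx ι),
          fun v => (some_mem_nonsingularReductionSubgroupAtPlace_iff v h).mpr (hns v)⟩

end Locus

section Torsion

open Polynomial

variable {W : WeierstrassCurve ℚ} [W.IsElliptic] [W.IsIntegral ℤ] {K : Type} [Field K] [NumberField K]
  {p : ℕ} [Fact p.Prime]

/-- **`E(K) ∩ E⁽ⁿ⁰⁾` at an embedding is torsion-free, at every prime**: a point `(x, y) ∈ E(K)` with
`‖ι x‖_p > 1` and `z(ιP)` in the sigma disc is non-torsion. For `p ≥ 3` this is the tree's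
`not_isOfFinAddOrder_of_one_lt_norm_emb` (AEC VII.3.4). At `p = 2` the disc condition `‖z‖₂ < ½`
says `ιP ∈ Ê(4ℤ₂)`; the multiples of `P` stay in the pull-back of that subgroup
(`some_mem_sigmaDiscSubgroupEmb_iff`), and a multiple `R = (x', y')` of prime order `q` is impossible:
for `q` odd by `val_le_one_of_zsmul_eq_zero` (`ΨSq_q` has unit leading coefficient for the valuation
`‖ι ·‖₂`), for `q = 2` because `ψ₂²(x') = 4x'³ + b₂x'² + 2b₄x' + b₆ = 0` contradicts the dominance
of `4x'³` when `‖ι x'‖₂ = ‖z(ιR)‖₂⁻² > 4`. (AEC IV.6.1 at `p = 2`: order `2` forces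
`v(z) ≤ v(2) = 1`.) [Silverman AEC IV.6.1, IV.3.2(b), VII.3.4; Exercise 3.7 (method)]
[cite: SilvermanAEC2009, IV.6.1] -/
theorem not_isOfFinAddOrder_of_inSigmaDisc_emb [(W.baseChange K).IsElliptic] (ι : K →+* ℚ_[p])
    {x y : K} (h : (W.baseChange K).toAffine.Nonsingular x y) (hx : 1 < ‖ι x‖)
    (hdisc : InSigmaDisc p (-ι x / ι y)) :
    ¬ IsOfFinAddOrder (.some x y h : (W.baseChange K).toAffine.Point) := by
  by_cases hp2 : p ≠ 2
  · exact not_isOfFinAddOrder_of_one_lt_norm_emb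
      (by have := (Fact.out : p.Prime).two_le; omega) ι h hx
  rw [not_ne_iff] at hp2
  subst hp2
  intro hfin
  haveI : (W.baseChange K).IsIntegral (embValuation ι).integer := isIntegral_integer_embValuation ι
  have hprime : (2 : ℕ).Prime := Fact.out
  -- the point lies in the pull-back of `Ê(4ℤ₂)` along `ι`
  have hPmem := (some_mem_sigmaDiscSubgroupEmb_iff (W := W) ι h).mpr ⟨hx, hdisc⟩
  -- a multiple of prime order, still in that subgroup
  set P : (W.baseChange K).toAffine.Point := .some x y h with hPdef
  have hN : 0 < addOrderOf P := hfin.addOrderOf_pos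
  have hN1 : addOrderOf P ≠ 1 := by
    rw [Ne, AddMonoid.addOrderOf_eq_one_iff]; exact WeierstrassCurve.Affine.Point.some_ne_zero h
  obtain ⟨q, hq, hqN⟩ := Nat.exists_prime_and_dvd hN1
  obtain ⟨m, hm⟩ := hqN
  have hm0 : m ≠ 0 := by rintro rfl; rw [mul_zero] at hm; omega
  have hmlt : m < addOrderOf P := by
    rw [hm]; exact lt_mul_left (Nat.pos_of_ne_zero hm0) hq.one_lt
  have hRmem := AddSubgroup.nsmul_mem _ hPmem m
  set R := m • P with hRdef
  have hR0 : R ≠ 0 := nsmul_ne_zero_of_lt_addOrderOf hm0 hmlt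
  have hqR : q • R = 0 := by
    rw [hRdef, ← mul_nsmul, Nat.mul_comm m q, ← hm]; exact addOrderOf_nsmul_eq_zero P
  rcases hR : R with _ | ⟨x', y', h'⟩
  · exact hR0 hR
  rw [hR] at hRmem hqR
  obtain ⟨hx', hdisc'⟩ := (some_mem_sigmaDiscSubgroupEmb_iff ι h').mp hRmem
  have hqR' : (q : ℤ) • (.some x' y' h' : (W.baseChange K).toAffine.Point) = 0 := by
    rw [natCast_zsmul]; exact hqR
  by_cases hq2 : q = 2
  · -- `q = 2`: `ψ₂²(x') = 0`, impossible by dominance of `4x'³`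
    subst hq2
    have hΨ : (W.baseChange K).Ψ₂Sq.eval x' = 0 := by
      simp only [Nat.cast_ofNat] at hqR'
      have := ((W.baseChange K).zsmul_some_eq_zero_iff_eval_ΨSq h' 2).mp hqR'
      rwa [WeierstrassCurve.ΨSq_two] at this
    have hdeg : (W.baseChange K).Ψ₂Sq.natDegree ≤ 3 := (W.baseChange K).natDegree_Ψ₂Sq_le
    have hlead : (W.baseChange K).Ψ₂Sq.coeff 3 = 4 := (W.baseChange K).coeff_Ψ₂Sq
    have hcoeff : ∀ i, embValuation ι ((W.baseChange K).Ψ₂Sq.coeff i) ≤ 1 := fun i => by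
      obtain ⟨M, hM⟩ :=
        (inferInstance : (W.baseChange K).IsIntegral (embValuation ι).integer).integral
      have hmap : (W.baseChange K).Ψ₂Sq = (M.Ψ₂Sq).map (algebraMap (embValuation ι).integer K) := by
        rw [← WeierstrassCurve.map_Ψ₂Sq, hM, WeierstrassCurve.baseChange]
      rw [hmap, coeff_map]
      exact ((M.Ψ₂Sq).coeff i).2
    have hx1 : 1 ≤ embValuation ι x' := ((one_lt_embValuation_iff ι x').mpr hx').le
    -- `‖ι x'‖₂ > 4`: `‖z(ιR)‖ < ½` and `‖z(ιR)‖² = ‖ι x'‖⁻¹` (`‖ι y'‖² = ‖ι x'‖³`)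
    have hx4 : 4 < ‖ι x'‖ := by
      have hh : (W.baseChange ℚ_[2]).toAffine.Nonsingular (ι x') (ι y') :=
        (Affine.baseChange_nonsingular (W := W.toAffine) (f := ι.toRatAlgHom)
          ι.toRatAlgHom.toRingHom.injective x' y').mpr h'
      obtain ⟨hsq, hxy⟩ := (W.baseChange ℚ_[2]).norm_sq_eq_norm_cube hh.1 hx'
      have hx0 : 0 < ‖ι x'‖ := one_pos.trans hx'
      have hy0 : 0 < ‖ι y'‖ := hx0.trans hxy
      have hz : ‖ι x'‖ / ‖ι y'‖ < 2⁻¹ := by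
        have hd := hdisc'
        unfold InSigmaDisc at hd
        rw [neg_div, norm_neg, norm_div] at hd
        have hrad : ((2 : ℕ) : ℝ) ^ (-(1 / (((2 : ℕ) : ℝ) - 1))) = 2⁻¹ := by
          rw [show (-(1 / (((2 : ℕ) : ℝ) - 1))) = (-1 : ℝ) by norm_num, Nat.cast_ofNat,
            Real.rpow_neg_one]
        rwa [hrad] at hd
      rw [div_lt_iff₀ hy0] at hz
      have h2 : 2 * ‖ι x'‖ < ‖ι y'‖ := by linarith
      have h4 : 4 * ‖ι x'‖ ^ 2 < ‖ι y'‖ ^ 2 := by nlinarith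
      rw [hsq] at h4
      nlinarith [pow_pos hx0 2]
    have hdom : 1 < embValuation ι ((W.baseChange K).Ψ₂Sq.coeff 3) * embValuation ι x' := by
      rw [hlead, embValuation_apply, embValuation_apply, ← NNReal.coe_lt_coe, NNReal.coe_one,
        NNReal.coe_mul, coe_nnnorm, coe_nnnorm, map_ofNat]
      have h4 : ‖(4 : ℚ_[2])‖ = 4⁻¹ := by
        rw [show (4 : ℚ_[2]) = ((2 : ℕ) : ℚ_[2]) ^ 2 by norm_num, norm_pow, Padic.norm_p]
        norm_num
      rw [h4, ← div_eq_inv_mul, lt_div_iff₀ (by norm_num : (0 : ℝ) < 4), one_mul]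
      exact hx4
    have hval := val_eval_eq_mul_pow hcoeff hdeg hx1 hdom
    rw [hΨ, map_zero] at hval
    have hc : 0 < embValuation ι ((W.baseChange K).Ψ₂Sq.coeff 3) := by
      refine pos_of_ne_zero fun h0 => ?_
      rw [h0, zero_mul] at hdom
      exact not_lt_of_ge zero_le_one hdom
    exact (mul_pos hc (pow_pos (zero_lt_one.trans_le hx1) 3)).ne hval
  · -- `q` odd: `ΨSq_q` has unit leading coefficient (`val_le_one_of_zsmul_eq_zero`)
    have hwq : embValuation ι ((q : ℤ) : K) = 1 := by
      rw [embValuation_apply, ← NNReal.coe_eq_one, coe_nnnorm, Int.cast_natCast, map_natCast,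
        Padic.norm_natCast_eq_one_iff]
      exact (Nat.coprime_primes hprime hq).mpr (Ne.symm hq2)
    have := val_le_one_of_zsmul_eq_zero (V := W.baseChange K) hwq hqR'
    rw [embValuation_apply, ← NNReal.coe_le_coe, NNReal.coe_one, coe_nnnorm] at this
    exact absurd hx' (not_lt.mpr this)

/-- **Points of the `K`-locus are admissible** (every prime): a point satisfying the local conditions
over `K` is non-torsion (an embedding `K → ℚ_p` exists as soon as `p` is totally split).
[Balakrishnan–Çiperiani–Stein 2015, §4.1] [cite: BalakrishnanCiperianiStein2015, §4.1] -/
theorem isAdmissibleK_of_satisfiesLocalConditionsK [(W.baseChange K).IsElliptic] (ι₀ : K →+* ℚ_[p])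
    {P : (W.baseChange K).toAffine.Point} (hP : W.SatisfiesLocalConditionsK p K P) :
    W.IsAdmissibleK p K P := by
  rcases P with _ | ⟨x, y, h⟩
  · exact hP.elim
  · exact ⟨not_isOfFinAddOrder_of_inSigmaDisc_emb ι₀ h (hP.1 ι₀).1 (hP.1 ι₀).2, hP⟩

end Torsion

/-! ### The parallelogram law of the sigma-squared formula over `K` -/

section Parallelogram

/-- **The sigma-squared `K`-formula satisfies the parallelogram law on generic admissible pairs**
(`p` totally split in `K`, a sigma-squared pair of `W ⊗ ℚ_p` exists): with `𝔡ᵢ = 𝔡(x(Pᵢ))`,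
`Σᵢ(ι) = Σ_p(z(ιPᵢ))` (`P₃ = P + Q`, `P₄ = P − Q`), `δ = x(P) − x(Q)`:
`N𝔡₃N𝔡₄ = N𝔡₁²N𝔡₂²N(δ)²` (Néron's local laws at the finite places of `K`,
`absNorm_denominatorIdeal_parallelogram`), `Σ₃(ι)Σ₄(ι) = ι(δ)²Σ₁(ι)²Σ₂(ι)²` at each embedding
(`padicSigmaSqEval_theta_emb`) and `∏_ι ι(δ) = N(δ)` (`prod_embeddings_eq_norm`), so that
`ĥ(P+Q) + ĥ(P−Q) = log_p(N𝔡₃N𝔡₄) − Σ_ι log_p(Σ₃Σ₄) = 2ĥ(P) + 2ĥ(Q)`. The printed argument of MST 2006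
§2.6–2.8 run on `Σ = σ²`; valid at `p = 2`. [Mazur–Stein–Tate 2006, §2.6–2.8;
Balakrishnan–Çiperiani–Stein 2015, §4.1 eq. (4.1)] [cite: MazurSteinTate2006, §2.8] -/
theorem canonicalPAdicHeightSqK_parallelogram_of_exists (W : WeierstrassCurve ℚ) [W.IsElliptic]
    [W.IsIntegral ℤ] (K : Type) [Field K] [NumberField K] (p : ℕ) [Fact p.Prime]
    (hex : ∃ Sq : PowerSeries ℚ_[p], ∃ c : ℚ_[p], (W.baseChange ℚ_[p]).IsMazurTateSigmaSqPair Sq c)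
    (hsplit : Fintype.card (K →+* ℚ_[p]) = Module.finrank ℚ K)
    (P Q : (W.baseChange K).toAffine.Point) (hP : W.SatisfiesLocalConditionsK p K P)
    (hQ : W.SatisfiesLocalConditionsK p K Q) (hsub : P - Q ≠ 0) (hadd : P + Q ≠ 0) :
    W.canonicalPAdicHeightSqK p K (P + Q) + W.canonicalPAdicHeightSqK p K (P - Q) =
      2 * W.canonicalPAdicHeightSqK p K P + 2 * W.canonicalPAdicHeightSqK p K Q := by
  have hmul : padicLog_mul p := padicLog_mul_holds p
  -- the subgroup: `P ± Q` again satisfy the local conditions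
  obtain ⟨H, hH⟩ := W.exists_addSubgroup_coe_eq_localConditionsLocusK_of_isIntegral K p
  have hmem : ∀ R, R ∈ H ↔ R = 0 ∨ W.SatisfiesLocalConditionsK p K R := fun R => by
    rw [← SetLike.mem_coe, hH]; rfl
  have hPH : P ∈ H := (hmem P).mpr (Or.inr hP)
  have hQH : Q ∈ H := (hmem Q).mpr (Or.inr hQ)
  have hS' : W.SatisfiesLocalConditionsK p K (P + Q) :=
    ((hmem _).mp (H.add_mem hPH hQH)).resolve_left hadd
  have hD' : W.SatisfiesLocalConditionsK p K (P - Q) :=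
    ((hmem _).mp (H.sub_mem hPH hQH)).resolve_left hsub
  -- coordinates of the four points
  rcases P with _ | ⟨x₁, y₁, h₁⟩
  · exact hP.elim
  rcases Q with _ | ⟨x₂, y₂, h₂⟩
  · exact hQ.elim
  have hx : x₁ ≠ x₂ := X_ne_of_sub_ne_zero_of_add_ne_zero h₁ h₂ hsub hadd
  rcases hS : (.some x₁ y₁ h₁ : (W.baseChange K).toAffine.Point) + .some x₂ y₂ h₂ with _ | ⟨x₃, y₃, h₃⟩
  · exact (hadd hS).elim
  rcases hD : (.some x₁ y₁ h₁ : (W.baseChange K).toAffine.Point) - .some x₂ y₂ h₂ with _ | ⟨x₄, y₄, h₄⟩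
  · exact (hsub hD).elim
  rw [hS] at hS'
  rw [hD] at hD'
  obtain ⟨hι₁, hns₁⟩ := hP
  obtain ⟨hι₂, hns₂⟩ := hQ
  obtain ⟨hι₃, -⟩ := hS'
  obtain ⟨hι₄, -⟩ := hD'
  -- the denominator identity and its logarithm
  have hden := absNorm_denominatorIdeal_parallelogram h₁ h₂ h₃ h₄ hx hS hD fun v => ⟨hns₁ v, hns₂ v⟩
  have hN0 : ∀ x : K, ((Ideal.absNorm (denominatorIdeal K x) : ℚ) : ℚ_[p]) ≠ 0 := fun x => by
    exact_mod_cast Ideal.absNorm_eq_zero_iff.not.mpr (denominatorIdeal_ne_bot K x)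
  have hδ : ((Algebra.norm ℚ (x₁ - x₂) : ℚ) : ℚ_[p]) ≠ 0 := by
    exact_mod_cast Algebra.norm_ne_zero_iff.mpr (sub_ne_zero.mpr hx)
  have hdenp : ((Ideal.absNorm (denominatorIdeal K x₃) : ℚ) : ℚ_[p]) *
      ((Ideal.absNorm (denominatorIdeal K x₄) : ℚ) : ℚ_[p]) =
        ((Ideal.absNorm (denominatorIdeal K x₁) : ℚ) : ℚ_[p]) ^ 2 *
          ((Ideal.absNorm (denominatorIdeal K x₂) : ℚ) : ℚ_[p]) ^ 2 *
          ((Algebra.norm ℚ (x₁ - x₂) : ℚ) : ℚ_[p]) ^ 2 := by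
    have := congrArg (fun q : ℚ => (q : ℚ_[p])) hden
    push_cast at this ⊢
    exact this
  have hlogd : padicLog p ((Ideal.absNorm (denominatorIdeal K x₃) : ℚ) : ℚ_[p]) +
      padicLog p ((Ideal.absNorm (denominatorIdeal K x₄) : ℚ) : ℚ_[p]) =
        2 * padicLog p ((Ideal.absNorm (denominatorIdeal K x₁) : ℚ) : ℚ_[p]) +
          2 * padicLog p ((Ideal.absNorm (denominatorIdeal K x₂) : ℚ) : ℚ_[p]) +
          2 * padicLog p ((Algebra.norm ℚ (x₁ - x₂) : ℚ) : ℚ_[p]) := by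
    rw [← hmul (hN0 x₃) (hN0 x₄), hdenp,
      hmul (mul_ne_zero (pow_ne_zero 2 (hN0 x₁)) (pow_ne_zero 2 (hN0 x₂))) (pow_ne_zero 2 hδ),
      hmul (pow_ne_zero 2 (hN0 x₁)) (pow_ne_zero 2 (hN0 x₂)), padicLog_sq (hN0 x₁),
      padicLog_sq (hN0 x₂), padicLog_sq hδ]
  -- the squared theta relation at each embedding and its logarithm
  have hlogS : ∀ ι : K →+* ℚ_[p],
      padicLog p (W.padicSigmaSqEval p (-ι x₃ / ι y₃)) +
          padicLog p (W.padicSigmaSqEval p (-ι x₄ / ι y₄)) =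
        2 * padicLog p (ι (x₁ - x₂)) + 2 * padicLog p (W.padicSigmaSqEval p (-ι x₁ / ι y₁)) +
          2 * padicLog p (W.padicSigmaSqEval p (-ι x₂ / ι y₂)) := fun ι => by
    have hθ' := W.padicSigmaSqEval_theta_emb p hex K ι h₁ h₂ h₃ h₄ hS hD (hι₁ ι).1 (hι₂ ι).1
    have hS₁ := W.padicSigmaSqEval_emb_ne_zero p K ι h₁ (hι₁ ι).1
    have hS₂ := W.padicSigmaSqEval_emb_ne_zero p K ι h₂ (hι₂ ι).1
    have hS₃ := W.padicSigmaSqEval_emb_ne_zero p K ι h₃ (hι₃ ι).1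
    have hS₄ := W.padicSigmaSqEval_emb_ne_zero p K ι h₄ (hι₄ ι).1
    have hδ₀ : ι x₁ - ι x₂ ≠ 0 := sub_ne_zero.mpr fun h => hx (ι.injective h)
    have hδ' : ι x₂ - ι x₁ ≠ 0 := sub_ne_zero.mpr fun h => hx (ι.injective h).symm
    rw [← hmul hS₃ hS₄, hθ', hmul (mul_ne_zero (pow_ne_zero 2 hδ') (pow_ne_zero 2 hS₁))
      (pow_ne_zero 2 hS₂), hmul (pow_ne_zero 2 hδ') (pow_ne_zero 2 hS₁), padicLog_sq hS₁,
      padicLog_sq hS₂, padicLog_sq hδ', ← neg_sub, padicLog_neg hδ₀, map_sub]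
  -- sum over the embeddings: the product formula at the totally split `p`
  have hsumδ : ∑ ι : K →+* ℚ_[p], padicLog p (ι (x₁ - x₂)) =
      padicLog p ((Algebra.norm ℚ (x₁ - x₂) : ℚ) : ℚ_[p]) := by
    rw [← prod_embeddings_eq_norm hsplit,
      padicLog_prod p _ _ (fun ι _ => (map_ne_zero ι).mpr (sub_ne_zero.mpr hx))]
  have key : (∑ ι : K →+* ℚ_[p], padicLog p (W.padicSigmaSqEval p (-ι x₃ / ι y₃))) +
      ∑ ι : K →+* ℚ_[p], padicLog p (W.padicSigmaSqEval p (-ι x₄ / ι y₄)) =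
        2 * padicLog p ((Algebra.norm ℚ (x₁ - x₂) : ℚ) : ℚ_[p]) +
          2 * ∑ ι : K →+* ℚ_[p], padicLog p (W.padicSigmaSqEval p (-ι x₁ / ι y₁)) +
          2 * ∑ ι : K →+* ℚ_[p], padicLog p (W.padicSigmaSqEval p (-ι x₂ / ι y₂)) := by
    rw [← Finset.sum_add_distrib, Finset.sum_congr rfl (fun ι _ => hlogS ι), Finset.sum_add_distrib,
      Finset.sum_add_distrib, ← Finset.mul_sum, ← Finset.mul_sum, ← Finset.mul_sum, hsumδ]
  rw [hS, hD]
  simp only [canonicalPAdicHeightSqK_some]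
  linear_combination hlogd - key

end Parallelogram

/-! ### The canonical `K`-datum in sigma-squared form: existence and uniqueness -/

section Existence

/-- **Existence of the canonical `p`-adic height datum over `K`, sigma-squared form**, for `W/ℚ`
elliptic with integer coefficients, `K` a number field, and `p` a prime TOTALLY SPLIT in `K` at which
`W ⊗ ℚ_p` carries a sigma-squared pair: the sigma-squared `K`-formula `ĥ^Σ_{p,K}` is, on admissible
points, the quadratic form of a symmetric bilinear torsion-vanishing pairing on `E(K)`. Proof as in
MST 2006 §1, §2.6–2.8: the admissible locus with `O` is a subgroup
(`exists_addSubgroup_coe_eq_localConditionsLocusK_of_isIntegral`), torsion-free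
(`not_isOfFinAddOrder_of_inSigmaDisc_emb`; an embedding exists since there are `[K:ℚ] ≥ 1` of them),
the generic parallelogram law (`canonicalPAdicHeightSqK_parallelogram_of_exists`) upgrades to the full
one (`parallelogram_of_generic`), and Jordan–von Neumann gives the pairing
(`exists_pairing_of_parallelogram`). Valid at `p = 2`. [Mazur–Stein–Tate 2006, §2.6–2.8;
Balakrishnan–Çiperiani–Stein 2015, §4.1 eq. (4.1); Perrin-Riou 1987, §1.2]
[cite: MazurSteinTate2006, §2.8] -/
theorem exists_isCanonicalSqK_of_exists (W : WeierstrassCurve ℚ) [W.IsElliptic] [W.IsIntegral ℤ]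
    (K : Type) [Field K] [NumberField K] (p : ℕ) [Fact p.Prime]
    (hex : ∃ Sq : PowerSeries ℚ_[p], ∃ c : ℚ_[p], (W.baseChange ℚ_[p]).IsMazurTateSigmaSqPair Sq c)
    (hsplit : Fintype.card (K →+* ℚ_[p]) = Module.finrank ℚ K) :
    ∃ DK : PAdicHeightDataK W p K, DK.IsCanonicalSq := by
  haveI : (W.baseChange K).IsElliptic := by rw [baseChange]; infer_instance
  obtain ⟨H, hH⟩ := W.exists_addSubgroup_coe_eq_localConditionsLocusK_of_isIntegral K p
  have hmem : ∀ P, P ∈ H ↔ P = 0 ∨ W.SatisfiesLocalConditionsK p K P := fun P => by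
    rw [← SetLike.mem_coe, hH]; rfl
  have hslc : ∀ P ∈ H, P ≠ 0 → W.SatisfiesLocalConditionsK p K P := fun P hP h0 =>
    ((hmem P).mp hP).resolve_left h0
  -- an embedding `K → ℚ_p` exists
  have hne : Nonempty (K →+* ℚ_[p]) := by
    rw [← Fintype.card_pos_iff, hsplit]; exact Module.finrank_pos
  obtain ⟨ι₀⟩ := hne
  -- `H` is torsion-free
  have htf' : ∀ P ∈ H, IsOfFinAddOrder P → P = 0 := by
    intro P hP hfin
    by_contra h0
    exact (isAdmissibleK_of_satisfiesLocalConditionsK ι₀ (hslc P hP h0)).1 hfin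
  -- the full parallelogram law on `H`
  have hfull := parallelogram_of_generic H htf' (W.canonicalPAdicHeightSqK p K) rfl
    fun P hP Q hQ hP0 hQ0 hPQ hPQ' =>
      W.canonicalPAdicHeightSqK_parallelogram_of_exists K p hex hsplit P Q (hslc P hP hP0)
        (hslc Q hQ hQ0) hPQ hPQ'
  obtain ⟨B, hsymm, htors, hdiag⟩ := exists_pairing_of_parallelogram H _ hfull
  exact ⟨⟨B, hsymm, fun P Q hP => htors P Q hP⟩, hsplit,
    fun P hP => hdiag P ((hmem P).mpr (Or.inr hP.2))⟩

/-- **Uniqueness of the canonical `K`-datum in sigma-squared form**, given admissible multiples over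
`K`: two data with `IsCanonicalSq` coincide (`PAdicHeightDataK.ext_of_sq_eq_on`).
[Mazur–Stein–Tate 2006, §1 ("extends uniquely"); Perrin-Riou 1987, §1.2] [folklore]
[cite: MazurSteinTate2006, §1] -/
theorem PAdicHeightDataK.isCanonicalSq_unique {W : WeierstrassCurve ℚ} {p : ℕ} [Fact p.Prime]
    {K : Type} [Field K] [NumberField K] {D₁ D₂ : PAdicHeightDataK W p K}
    (hS : ∀ P : (W.baseChange K).toAffine.Point, ¬ IsOfFinAddOrder P →
      ∃ m : ℕ, m ≠ 0 ∧ W.IsAdmissibleK p K (m • P))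
    (h₁ : D₁.IsCanonicalSq) (h₂ : D₂.IsCanonicalSq) : D₁ = D₂ :=
  PAdicHeightDataK.ext_of_sq_eq_on {P | W.IsAdmissibleK p K P} hS fun Q hQ => by
    rw [h₁.2 Q hQ, h₂.2 Q hQ]

/-- **The canonical `K`-datum in sigma-squared form exists uniquely** (`W ⊗ K` globally minimal, `p`
totally split with a sigma-squared pair; admissible multiples by `exists_admissibleK_nsmul_holds`).
[Mazur–Stein–Tate 2006, §1, §2.8; Balakrishnan–Çiperiani–Stein 2015, §4.1 eq. (4.1)]
[cite: MazurSteinTate2006, §2.8] -/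
theorem existsUnique_isCanonicalSqK_of_exists (W : WeierstrassCurve ℚ) [W.IsElliptic] [W.IsIntegral ℤ]
    (K : Type) [Field K] [NumberField K] [(W.baseChange K).IsGloballyMinimal] (p : ℕ) [Fact p.Prime]
    (hex : ∃ Sq : PowerSeries ℚ_[p], ∃ c : ℚ_[p], (W.baseChange ℚ_[p]).IsMazurTateSigmaSqPair Sq c)
    (hsplit : Fintype.card (K →+* ℚ_[p]) = Module.finrank ℚ K) :
    ∃! DK : PAdicHeightDataK W p K, DK.IsCanonicalSq := by
  obtain ⟨DK, hDK⟩ := exists_isCanonicalSqK_of_exists W K p hex hsplit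
  exact ⟨DK, hDK, fun D' hD' =>
    PAdicHeightDataK.isCanonicalSq_unique (exists_admissibleK_nsmul_holds W K p) hD' hDK⟩

/-! ### `p = 2` -/

/-- **THE canonical `2`-adic height datum over `K` exists, sigma-squared form** (`2` totally split in
`K`, e.g. `K = ℚ(√−7)`): for `W/ℚ` globally minimal with good ORDINARY reduction at `2`, under the
printed fact `mazurTate_sigmaSq_existsUnique_two` (Silverman 2005 §5 Rem. 2, which supplies the
sigma-squared pair of `W ⊗ ℚ₂` through `exists_isMazurTateSigmaSqPair_two`), there is a symmetric
bilinear torsion-vanishing pairing on `E(K)` whose quadratic form on `K`-admissible points is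
`log₂ N𝔡(x(P)) − Σ_ι log₂ Σ₂(z(ιP))`, i.e. a `DK : PAdicHeightDataK W 2 K` with `DK.IsCanonicalSq`.
[Mazur–Tate 1991, Thm. 3.1; Silverman 2005, §5 Rem. 2; Mazur–Stein–Tate 2006, §2.8;
Balakrishnan–Çiperiani–Stein 2015, §4.1 eq. (4.1)] [cite: Silverman2005DivPoly, §5 Rem. 2]
[cite: MazurSteinTate2006, §2.8] -/
theorem exists_isCanonicalSqK_two (hMT : mazurTate_sigmaSq_existsUnique_two) (W : WeierstrassCurve ℚ)
    [W.IsElliptic] [W.IsGloballyMinimal] (K : Type) [Field K] [NumberField K]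
    (hgood : W.HasGoodReductionAtPrime 2) (hord : ¬ (2 : ℤ) ∣ W.frobeniusTrace 2)
    (hsplit : Fintype.card (K →+* ℚ_[2]) = Module.finrank ℚ K) :
    ∃ DK : PAdicHeightDataK W 2 K, DK.IsCanonicalSq :=
  exists_isCanonicalSqK_of_exists W K 2 (W.exists_isMazurTateSigmaSqPair_two hMT hgood hord) hsplit

/-- **… and it is unique** when `W ⊗ K` is globally minimal. [Mazur–Stein–Tate 2006, §1 ("extends
uniquely"); Silverman 2005, §5 Rem. 2] [cite: Silverman2005DivPoly, §5 Rem. 2]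
[cite: MazurSteinTate2006, §2.8] -/
theorem existsUnique_isCanonicalSqK_two (hMT : mazurTate_sigmaSq_existsUnique_two)
    (W : WeierstrassCurve ℚ) [W.IsElliptic] [W.IsGloballyMinimal] (K : Type) [Field K] [NumberField K]
    [(W.baseChange K).IsGloballyMinimal] (hgood : W.HasGoodReductionAtPrime 2)
    (hord : ¬ (2 : ℤ) ∣ W.frobeniusTrace 2) (hsplit : Fintype.card (K →+* ℚ_[2]) = Module.finrank ℚ K) :
    ∃! DK : PAdicHeightDataK W 2 K, DK.IsCanonicalSq :=
  existsUnique_isCanonicalSqK_of_exists W K 2 (W.exists_isMazurTateSigmaSqPair_two hMT hgood hord)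
    hsplit

end Existence

/-! ### `p = 2` totally split in a quadratic field: the embedding form of the hypothesis -/

section SplitTwo

/-- **`2` splits in a quadratic field with `d_K ≡ 1 (mod 8)` — embedding form `#(K →+* ℚ₂) = [K : ℚ]`.**
For `[K : ℚ] = 2` write `K = ℚ(θ)`, `θ² = d_K·q²` (`NumberField.exists_discr_eq_mul_sq`); `d_K ≡ 1 (mod 8)`
makes `d_K` a square in `ℤ₂` (Hensel's lemma for `X² − d_K` at `1`: `‖1 − d_K‖₂ ≤ 2⁻³ < ‖2‖₂²`;
Serre, *Cours d'arithmétique*, II §3.3 Thm. 4; tree: `padicInt_isSquare_of_toZModPow_three_eq_one`), so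
`minpoly θ` splits in `ℚ₂` and `#(ℚ(θ) →ₐ ℚ₂) = deg minpoly θ = 2` (Marcus, *Number Fields*, Ch. 3
Thm. 25: `2` splits in `ℚ(√m)` iff `m ≡ 1 (mod 8)`). The `p = 2` twin of the odd-`p` computation in
`exists_isCanonicalK_of_ncard_primesOver_eq_two`. Example: `K = ℚ(√−7)`, `d_K = −7 ≡ 1 (mod 8)`.
[cite: Marcus2018, Ch. 3 Thm. 25] [cite: Serre1973, Ch. II §3.3 Thm 4] -/
theorem card_ringHom_padic_two_of_discr_mod_eight (K : Type) [Field K] [NumberField K]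
    (h2 : Module.finrank ℚ K = 2) (h8 : NumberField.discr K % 8 = 1) :
    Fintype.card (K →+* ℚ_[2]) = Module.finrank ℚ K := by
  -- `d_K` is a non-zero square in `ℚ_2`
  have hsqrt : ∃ s : ℚ_[2], s ≠ 0 ∧ s ^ 2 = ((NumberField.discr K : ℤ) : ℚ_[2]) := by
    set d : ℤ := NumberField.discr K with hd_def
    have hd0 : d ≠ 0 := NumberField.discr_ne_zero K
    have hmod : Int.ModEq ((2 ^ 3 : ℕ) : ℤ) d 1 := by
      rw [Int.ModEq]
      norm_num
      omega
    have hd1 : PadicInt.toZModPow 3 (d : ℤ_[2]) = 1 := by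
      rw [map_intCast, (ZMod.intCast_eq_intCast_iff _ _ _).mpr hmod, Int.cast_one]
    obtain ⟨r, hr⟩ :=
      Literature.NumberTheory.QuadraticForms.padicInt_isSquare_of_toZModPow_three_eq_one (p := 2) hd1
    refine ⟨((r : ℤ_[2]) : ℚ_[2]), fun h0 => hd0 ?_, ?_⟩
    · have hr0 : r = 0 := PadicInt.coe_eq_zero.mp h0
      have : (d : ℤ_[2]) = 0 := by rw [hr, hr0, mul_zero]
      exact_mod_cast this
    · rw [sq, ← PadicInt.coe_mul, ← hr]; simp
  -- hence `X² - d_K` splits in `ℚ_2`, and so does `minpoly θ` for a square-root generator `θ`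
  obtain ⟨θ₀, c, hθ₀, hc⟩ :=
    Literature.NumberTheory.QuadraticFields.Quadratic.exists_sq_eq_algebraMap (F := ℚ) (K := K) h2
  obtain ⟨q, hq0, hdq⟩ := NumberField.exists_discr_eq_mul_sq h2 hθ₀ hc
  set θ : K := algebraMap ℚ K q * θ₀ with hθdef
  have hθsq : θ ^ 2 = algebraMap ℚ K (NumberField.discr K : ℚ) := by
    rw [hθdef, mul_pow, ← map_pow, hc, ← map_mul, hdq, mul_comm]
  have hθ : θ ∉ Set.range (algebraMap ℚ K) := fun ⟨r, hr⟩ => hθ₀ ⟨r / q, by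
    rw [map_div₀, hr, hθdef, mul_div_cancel_left₀ _ ((map_ne_zero _).mpr hq0)]⟩
  obtain ⟨s, -, hs⟩ := hsqrt
  have hint : _root_.IsIntegral ℚ θ := .of_finite ℚ θ
  set P : Polynomial ℚ := Polynomial.X ^ 2 - Polynomial.C (NumberField.discr K : ℚ) with hP
  have hPθ : Polynomial.aeval θ P = 0 := by simp [hP, hθsq]
  have hPmap : P.map (algebraMap ℚ ℚ_[2]) =
      (Polynomial.X - Polynomial.C s) * (Polynomial.X + Polynomial.C s) := by
    have hds : (algebraMap ℚ ℚ_[2]) (NumberField.discr K : ℚ) = s * s := by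
      rw [← sq, hs]; simp
    rw [hP, Polynomial.map_sub, Polynomial.map_pow, Polynomial.map_X, Polynomial.map_C, hds,
      Polynomial.C_mul]
    ring
  have hsplits : ((minpoly ℚ θ).map (algebraMap ℚ ℚ_[2])).Splits := by
    refine Polynomial.Splits.of_dvd ?_ ?_ (Polynomial.map_dvd _ (minpoly.dvd ℚ θ hPθ)) <;>
      rw [hPmap]
    · exact (Polynomial.Splits.X_sub_C s).mul (Polynomial.Splits.X_add_C s)
    · exact mul_ne_zero (Polynomial.X_sub_C_ne_zero s) (Polynomial.X_add_C_ne_zero s)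
  have hdeg : (minpoly ℚ θ).natDegree = 2 :=
    le_antisymm ((minpoly.natDegree_le θ).trans h2.le)
      ((minpoly.two_le_natDegree_iff hint).mpr fun ⟨r, hr⟩ => hθ ⟨r, hr⟩)
  have htop : IntermediateField.adjoin ℚ {θ} = ⊤ :=
    IntermediateField.eq_of_le_of_finrank_le le_top
      (by rw [IntermediateField.finrank_top', IntermediateField.adjoin.finrank hint, hdeg, h2])
  have hcard := IntermediateField.card_algHom_adjoin_integral ℚ (K := ℚ_[2]) hint
    (Algebra.IsSeparable.isSeparable ℚ θ) hsplits
  rw [hdeg] at hcard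
  have e : IntermediateField.adjoin ℚ {θ} ≃ₐ[ℚ] K :=
    (IntermediateField.equivOfEq htop).trans IntermediateField.topEquiv
  calc Fintype.card (K →+* ℚ_[2]) = Nat.card (K →+* ℚ_[2]) := Fintype.card_eq_nat_card
    _ = Nat.card (K →ₐ[ℚ] ℚ_[2]) := Nat.card_congr RingHom.equivRatAlgHom
    _ = Nat.card (IntermediateField.adjoin ℚ {θ} →ₐ[ℚ] ℚ_[2]) :=
        (Nat.card_congr (AlgEquiv.arrowCongr e (AlgEquiv.refl : ℚ_[2] ≃ₐ[ℚ] ℚ_[2]))).symm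
    _ = 2 := hcard
    _ = Module.finrank ℚ K := h2.symm

/-- **THE canonical `2`-adic height datum over a quadratic field in which `2` splits, sigma-squared
form** — the instantiable form of `exists_isCanonicalSqK_two`: for `W/ℚ` globally minimal with good
ordinary reduction at `2`, `K` quadratic with `d_K ≡ 1 (mod 8)` (e.g. `K = ℚ(√−7)`, `d_K = −7`), under
`mazurTate_sigmaSq_existsUnique_two`, there is `DK : PAdicHeightDataK W 2 K` with `DK.IsCanonicalSq`.
[Silverman 2005, §5 Rem. 2; Mazur–Stein–Tate 2006, §2.8; Marcus, Ch. 3 Thm. 25]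
[cite: Silverman2005DivPoly, §5 Rem. 2] [cite: MazurSteinTate2006, §2.8] [cite: Marcus2018, Ch. 3 Thm. 25] -/
theorem exists_isCanonicalSqK_two_of_discr_mod_eight (hMT : mazurTate_sigmaSq_existsUnique_two)
    (W : WeierstrassCurve ℚ) [W.IsElliptic] [W.IsGloballyMinimal] (K : Type) [Field K] [NumberField K]
    (h2 : Module.finrank ℚ K = 2) (h8 : NumberField.discr K % 8 = 1)
    (hgood : W.HasGoodReductionAtPrime 2) (hord : ¬ (2 : ℤ) ∣ W.frobeniusTrace 2) :
    ∃ DK : PAdicHeightDataK W 2 K, DK.IsCanonicalSq :=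
  exists_isCanonicalSqK_two hMT W K hgood hord (card_ringHom_padic_two_of_discr_mod_eight K h2 h8)

/-- … and uniquely so when `W ⊗ K` is globally minimal. [cite: Silverman2005DivPoly, §5 Rem. 2]
[cite: MazurSteinTate2006, §2.8] -/
theorem existsUnique_isCanonicalSqK_two_of_discr_mod_eight (hMT : mazurTate_sigmaSq_existsUnique_two)
    (W : WeierstrassCurve ℚ) [W.IsElliptic] [W.IsGloballyMinimal] (K : Type) [Field K] [NumberField K]
    [(W.baseChange K).IsGloballyMinimal] (h2 : Module.finrank ℚ K = 2)
    (h8 : NumberField.discr K % 8 = 1) (hgood : W.HasGoodReductionAtPrime 2)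
    (hord : ¬ (2 : ℤ) ∣ W.frobeniusTrace 2) : ∃! DK : PAdicHeightDataK W 2 K, DK.IsCanonicalSq :=
  existsUnique_isCanonicalSqK_two hMT W K hgood hord (card_ringHom_padic_two_of_discr_mod_eight K h2 h8)

end SplitTwo

end WeierstrassCurve
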